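import Literature.MathematicalPhysics.QuantumFieldTheory.LatticeGaugeDobrushinPoincare
import HarnessLib

/-!
# Venture YMGap — ROBUST-BALL input, part 1 (abstract measure theory): a Kantorovich–Rubinstein modulus of a pair of
# probability measures survives a common bounded Lipschitz tilt with the factor `e^δ (1 + D ℓ)`; the tilt direction costs
# `Θ · θ · e^{2θ}` — no curvature, no Poincaré inequality, no Dirichlet form

HONEST FRAMING: venture file of the cell `pub-ymgap` (QuantumFields programme), track Y2 ROBUST-BALL; elementary measure
theory on an abstract measurable space `S` with a "distance" `r` (the one-link space `SU(N)` with the Frobenius distance in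
part 2, `OneLinkTiltStability`).  Nothing about lattices, the continuum or a mass gap is said here.

CONTENT.  For probability measures `μ, μ'` write `μ^U := e^U μ / μ(e^U)` (`Measure.tilted`).
* `abs_integral_tilted_sub_tilted_le` — if `|μ(ψ) − μ'(ψ)| ≤ A · Lip ψ` for all bounded measurable `r`-Lipschitz `ψ`
  (a Kantorovich–Rubinstein modulus `A` of the pair) then, for every measurable `U` of oscillation `≤ δ` (`U a − U b ≤ δ`)
  which is `ℓ`-Lipschitz, `|μ^U(φ) − μ'^U(φ)| ≤ A · e^δ · Lip φ · (1 + D ℓ)`, `D` = an `r`-diameter bound.  Proof: centre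
  `φ` at the `μ'^U`-mean and feed `ψ := (φ − μ'^U(φ)) · e^U / μ(e^U)` to the hypothesis — `μ'(ψ) = 0`,
  `μ(ψ) = μ^U(φ) − μ'^U(φ)`, `Lip ψ ≤ e^δ Lip φ (1 + D ℓ)` since `0 ≤ e^U/μ(e^U) ≤ e^δ` and
  `|e^{U a} − e^{U b}|/μ(e^U) ≤ e^δ ℓ r(a,b)`.  The `ℓ`-dependence is necessary (two-point example in part 2's docstring).
* `abs_integral_tilted_sub_tilted_le_of_centre` — the tilt direction: `|μ^U(φ) − μ^{U'}(φ)| ≤ Θ θ e^{2θ}` when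
  `|φ − b₀| ≤ Θ` and `|U − U' − w₀| ≤ θ` pointwise (one tilt step `Cov_ν(e^W, φ)/ν(e^W)`, `ν = μ^{U'}`, `W = U − U'`,
  covariance through the two variances `≤ (θ e^{w₀+θ})²`, `≤ Θ²`, denominator `≥ e^{w₀−θ}`); Poincaré-free, valid for
  every tilt.  `exists_centre_of_lipschitz`: the mid-range centre gives `Θ = Lip φ · D / 2`.
* helpers: `integrable_exp_of_abs_le`, `exp_div_integral_exp_le`, `abs_sub_integral_le_of_lipschitz`,
  `integral_sq_sub_mean_le_of_abs_sub_le` (variance `≤ T²` when `|f − c| ≤ T`).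
Mechanism references (nothing is cited as a fact): H.-O. Georgii, *Gibbs Measures and Phase Transitions* (1988), Ch. 8
(stability of Dobrushin's comparison); R. L. Dobrushin, Theory Probab. Appl. 15 (1970), §5.
-/

noncomputable section

open MeasureTheory ProbabilityTheory Real
open Literature.MathematicalPhysics.QuantumFieldTheory

namespace Summit.Ventures.YMGap.TiltStability

/-! ## The modulus direction: a common bounded Lipschitz tilt costs the factor `e^δ (1 + D ℓ)` -/

section Abstract

variable {S : Type*} [MeasurableSpace S]

/-- `e^U` is integrable against a finite measure when `U` is measurable and bounded. [folklore] -/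
theorem integrable_exp_of_abs_le {ν : Measure S} [IsFiniteMeasure ν] {U : S → ℝ} (hU : Measurable U) {C : ℝ}
    (hC : ∀ s, |U s| ≤ C) : Integrable (fun s => exp (U s)) ν :=
  integrable_of_measurable_of_abs_le hU.exp (C := exp C) fun s => by
    rw [abs_of_nonneg (exp_pos _).le]
    exact exp_le_exp.2 ((le_abs_self _).trans (hC s))

/-- **The normalised tilt density is at most `e^δ`**: if `U a − U b ≤ δ` for all `a, b` (oscillation `≤ δ`) then
`e^{U a} / ∫ e^U dμ ≤ e^δ` for a probability measure `μ`. [folklore] -/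
theorem exp_div_integral_exp_le {μ : Measure S} [IsProbabilityMeasure μ] {U : S → ℝ} {δ : ℝ}
    (hU : Measurable U) (hUb : ∃ C, ∀ s, |U s| ≤ C) (hUδ : ∀ a b, U a - U b ≤ δ) (a : S) :
    exp (U a) / ∫ s, exp (U s) ∂μ ≤ exp δ := by
  obtain ⟨C, hC⟩ := hUb
  have hi : Integrable (fun s => exp (U s)) μ := integrable_exp_of_abs_le hU hC
  have hZ : exp (U a - δ) ≤ ∫ s, exp (U s) ∂μ := by
    calc exp (U a - δ) = ∫ _s, exp (U a - δ) ∂μ := by simp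
      _ ≤ ∫ s, exp (U s) ∂μ :=
          integral_mono (integrable_const _) hi fun s => exp_le_exp.2 (by linarith [hUδ a s])
  have hZpos : 0 < ∫ s, exp (U s) ∂μ := (exp_pos _).trans_le hZ
  rw [div_le_iff₀ hZpos]
  calc exp (U a) = exp δ * exp (U a - δ) := by rw [← exp_add]; ring_nf
    _ ≤ exp δ * ∫ s, exp (U s) ∂μ := mul_le_mul_of_nonneg_left hZ (exp_pos _).le

/-- **A value of a Lipschitz function is within `L · D` of its mean** on a probability space of `r`-diameter `≤ D`.
[folklore] -/
theorem abs_sub_integral_le_of_lipschitz {ν : Measure S} [IsProbabilityMeasure ν] {r : S → S → ℝ} {φ : S → ℝ}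
    {L D : ℝ} (hrD : ∀ a b, r a b ≤ D) (hφ : Measurable φ) (hφb : ∃ C, ∀ s, |φ s| ≤ C) (hL : 0 ≤ L)
    (hφL : ∀ a b, |φ a - φ b| ≤ L * r a b) (b : S) :
    |φ b - ∫ s, φ s ∂ν| ≤ L * D := by
  obtain ⟨C, hC⟩ := hφb
  have hφi : Integrable φ ν := integrable_of_measurable_of_abs_le hφ hC
  have h1 : φ b - ∫ s, φ s ∂ν = ∫ s, (φ b - φ s) ∂ν := by
    rw [integral_sub (integrable_const _) hφi, integral_const, probReal_univ, one_smul]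
  rw [h1]
  calc |∫ s, (φ b - φ s) ∂ν| ≤ ∫ s, |φ b - φ s| ∂ν := abs_integral_le_integral_abs
    _ ≤ ∫ _s, L * D ∂ν := by
        refine integral_mono_of_nonneg (ae_of_all _ fun s => abs_nonneg _) (integrable_const _)
          (ae_of_all _ fun s => ?_)
        exact (hφL b s).trans (mul_le_mul_of_nonneg_left (hrD b s) hL)
    _ = L * D := by simp

/-- **Stability of a Kantorovich–Rubinstein modulus under a common bounded Lipschitz tilt.**  Let `μ, μ'` be probability
measures on `S`, `r ≥ 0` a "distance" of diameter `≤ D`, and suppose the pair `(μ, μ')` has modulus `A` on bounded measurable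
`r`-Lipschitz test functions: `|μ(ψ) − μ'(ψ)| ≤ A · Lip ψ`.  Then for every measurable `U` of oscillation `≤ δ`
(`U a − U b ≤ δ`) which is `ℓ`-Lipschitz, the tilted pair `(μ^U, μ'^U)`, `μ^U = e^U μ / μ(e^U)`, has modulus
`A · e^δ · (1 + D ℓ)`: `|μ^U(φ) − μ'^U(φ)| ≤ A · e^δ · Lip φ · (1 + D ℓ)`.  Proof: with `φ_c := φ − μ'^U(φ)` and
`ψ := φ_c · e^U / μ(e^U)` one has `μ'(ψ) = 0`, `μ(ψ) = μ^U(φ) − μ'^U(φ)` and `Lip ψ ≤ e^δ Lip φ (1 + D ℓ)`. [folklore] -/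
theorem abs_integral_tilted_sub_tilted_le {μ μ' : Measure S} [IsProbabilityMeasure μ] [IsProbabilityMeasure μ']
    {r : S → S → ℝ} {U φ : S → ℝ} {A δ ℓ D L : ℝ}
    (hr : ∀ a b, 0 ≤ r a b) (hrD : ∀ a b, r a b ≤ D) (hD : 0 ≤ D)
    (hU : Measurable U) (hUb : ∃ C, ∀ s, |U s| ≤ C) (hUδ : ∀ a b, U a - U b ≤ δ)
    (hℓ : 0 ≤ ℓ) (hUℓ : ∀ a b, |U a - U b| ≤ ℓ * r a b)
    (hφ : Measurable φ) (hφb : ∃ C, ∀ s, |φ s| ≤ C) (hL : 0 ≤ L) (hφL : ∀ a b, |φ a - φ b| ≤ L * r a b)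
    (hA : ∀ (ψ : S → ℝ) (M : ℝ), Measurable ψ → (∃ C, ∀ s, |ψ s| ≤ C) → 0 ≤ M →
      (∀ a b, |ψ a - ψ b| ≤ M * r a b) → |∫ s, ψ s ∂μ - ∫ s, ψ s ∂μ'| ≤ A * M) :
    |∫ s, φ s ∂μ.tilted U - ∫ s, φ s ∂μ'.tilted U| ≤ A * (exp δ * L * (1 + D * ℓ)) := by
  obtain ⟨CU, hCU⟩ := hUb
  obtain ⟨Cφ, hCφ⟩ := hφb
  have hexpμ : Integrable (fun s => exp (U s)) μ := integrable_exp_of_abs_le hU hCU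
  have hexpμ' : Integrable (fun s => exp (U s)) μ' := integrable_exp_of_abs_le hU hCU
  set Z : ℝ := ∫ s, exp (U s) ∂μ with hZdef
  set Z' : ℝ := ∫ s, exp (U s) ∂μ' with hZ'def
  have hZpos : 0 < Z := integral_exp_pos hexpμ
  have hZ'pos : 0 < Z' := integral_exp_pos hexpμ'
  haveI : IsProbabilityMeasure (μ.tilted U) := isProbabilityMeasure_tilted hexpμ
  haveI : IsProbabilityMeasure (μ'.tilted U) := isProbabilityMeasure_tilted hexpμ'
  set m' : ℝ := ∫ s, φ s ∂μ'.tilted U with hm'def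
  -- the normalised density `ρ = e^U / Z` and its bounds
  set ρ : S → ℝ := fun s => exp (U s) / Z with hρdef
  have hρ_le : ∀ a, ρ a ≤ exp δ := fun a => exp_div_integral_exp_le hU ⟨CU, hCU⟩ hUδ a
  have hρ_nn : ∀ a, 0 ≤ ρ a := fun a => div_nonneg (exp_pos _).le hZpos.le
  have hρL : ∀ a b, |ρ a - ρ b| ≤ exp δ * ℓ * r a b := by
    intro a b
    have h1 := abs_exp_sub_exp_le_of_le (le_max_left (U a) (U b)) (le_max_right (U a) (U b))
    have hmax : exp (max (U a) (U b)) / Z ≤ exp δ := by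
      rcases le_total (U a) (U b) with h | h
      · rw [max_eq_right h]; exact hρ_le b
      · rw [max_eq_left h]; exact hρ_le a
    calc |ρ a - ρ b| = |exp (U a) - exp (U b)| / Z := by
          rw [hρdef]
          dsimp only
          rw [← sub_div, abs_div, abs_of_pos hZpos]
      _ ≤ exp (max (U a) (U b)) * |U a - U b| / Z := div_le_div_of_nonneg_right h1 hZpos.le
      _ = exp (max (U a) (U b)) / Z * |U a - U b| := by ring
      _ ≤ exp δ * (ℓ * r a b) := mul_le_mul hmax (hUℓ a b) (abs_nonneg _) (exp_pos _).le
      _ = exp δ * ℓ * r a b := by ring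
  -- the centred test function
  have hφc : ∀ b, |φ b - m'| ≤ L * D := fun b =>
    abs_sub_integral_le_of_lipschitz (ν := μ'.tilted U) hrD hφ ⟨Cφ, hCφ⟩ hL hφL b
  -- `ψ := ρ · (φ − m')`
  set ψ : S → ℝ := fun s => ρ s * (φ s - m') with hψdef
  have hψm : Measurable ψ := (hU.exp.div_const Z).mul (hφ.sub_const m')
  have hψb : ∃ C, ∀ s, |ψ s| ≤ C := ⟨exp δ * (L * D), fun s => by
    rw [hψdef]
    dsimp only
    rw [abs_mul, abs_of_nonneg (hρ_nn s)]
    exact mul_le_mul (hρ_le s) (hφc s) (abs_nonneg _) (exp_pos δ).le⟩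
  have hM0 : 0 ≤ exp δ * L * (1 + D * ℓ) := by positivity
  have hψL : ∀ a b, |ψ a - ψ b| ≤ exp δ * L * (1 + D * ℓ) * r a b := by
    intro a b
    have hsplit : ψ a - ψ b = ρ a * (φ a - φ b) + (ρ a - ρ b) * (φ b - m') := by
      rw [hψdef]; ring
    rw [hsplit]
    calc |ρ a * (φ a - φ b) + (ρ a - ρ b) * (φ b - m')|
        ≤ |ρ a * (φ a - φ b)| + |(ρ a - ρ b) * (φ b - m')| := abs_add_le _ _
      _ = ρ a * |φ a - φ b| + |ρ a - ρ b| * |φ b - m'| := by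
          rw [abs_mul, abs_mul, abs_of_nonneg (hρ_nn a)]
      _ ≤ exp δ * (L * r a b) + exp δ * ℓ * r a b * (L * D) :=
          add_le_add (mul_le_mul (hρ_le a) (hφL a b) (abs_nonneg _) (exp_pos δ).le)
            (mul_le_mul (hρL a b) (hφc b) (abs_nonneg _) (mul_nonneg (mul_nonneg (exp_pos δ).le hℓ) (hr a b)))
      _ = exp δ * L * (1 + D * ℓ) * r a b := by ring
  -- integral identities: `μ(ψ) = μ^U(φ) − m'` and `μ'(ψ) = 0`
  have hφi : ∀ (ν : Measure S) [IsFiniteMeasure ν], Integrable φ ν := fun ν _ =>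
    integrable_of_measurable_of_abs_le hφ hCφ
  have hI1 : ∫ s, ψ s ∂μ = ∫ s, φ s ∂μ.tilted U - m' := by
    have h1 : ∫ s, (φ s - m') ∂μ.tilted U = ∫ s, φ s ∂μ.tilted U - m' := by
      rw [integral_sub (hφi _) (integrable_const _), integral_const, probReal_univ, one_smul]
    rw [← h1, integral_tilted]
    simp only [smul_eq_mul]
    rfl
  have hI2 : ∫ s, ψ s ∂μ' = 0 := by
    have h1 : ∫ s, (φ s - m') ∂μ'.tilted U = 0 := by
      rw [integral_sub (hφi _) (integrable_const _), integral_const, probReal_univ, one_smul, hm'def, sub_self]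
    rw [integral_tilted] at h1
    simp only [smul_eq_mul] at h1
    have h2 : (fun s => ψ s) = fun s => (Z' / Z) * (exp (U s) / Z' * (φ s - m')) := by
      funext s
      rw [hψdef, hρdef]
      dsimp only
      field_simp
    rw [h2, integral_const_mul]
    change Z' / Z * ∫ s, exp (U s) / Z' * (φ s - m') ∂μ' = 0
    rw [h1, mul_zero]
  -- conclusion
  have key := hA ψ (exp δ * L * (1 + D * ℓ)) hψm hψb hM0 hψL
  rw [hI1, hI2, sub_zero] at key
  exact key

/-- **Variance is at most the mean square deviation from any centre**: `∫ (f − ∫ f)² dν ≤ T²` whenever `|f − c| ≤ T`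
pointwise (Popoviciu-type bound; `∫ (f − m)² = ∫ (f − c)² − (m − c)²`). [folklore] -/
theorem integral_sq_sub_mean_le_of_abs_sub_le {ν : Measure S} [IsProbabilityMeasure ν] {f : S → ℝ} {c T : ℝ}
    (hf : Measurable f) (hfb : ∃ C, ∀ s, |f s| ≤ C) (hT : ∀ s, |f s - c| ≤ T) :
    ∫ s, (f s - ∫ s', f s' ∂ν) ^ 2 ∂ν ≤ T ^ 2 := by
  obtain ⟨C, hC⟩ := hfb
  set m : ℝ := ∫ s', f s' ∂ν with hm
  have hfi : Integrable f ν := integrable_of_measurable_of_abs_le hf hC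
  have hfc : Integrable (fun s => f s - c) ν := hfi.sub (integrable_const _)
  have hfc2 : Integrable (fun s => (f s - c) ^ 2) ν :=
    integrable_of_measurable_of_abs_le ((hf.sub_const c).pow_const 2) (C := T ^ 2) fun s => by
      rw [abs_pow]; exact pow_le_pow_left₀ (abs_nonneg _) (hT s) 2
  have hmc : ∫ s, (f s - c) ∂ν = m - c := by
    rw [integral_sub hfi (integrable_const _), integral_const, probReal_univ, one_smul]
  have hexp : (fun s => (f s - m) ^ 2) = fun s => (f s - c) ^ 2 - 2 * (m - c) * (f s - c) + (m - c) ^ 2 := by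
    funext s; ring
  have i3 : Integrable (fun s => 2 * (m - c) * (f s - c)) ν := hfc.const_mul _
  have i1 : Integrable (fun s => (f s - c) ^ 2 - 2 * (m - c) * (f s - c)) ν := hfc2.sub i3
  have hI : ∫ s, (f s - m) ^ 2 ∂ν = ∫ s, (f s - c) ^ 2 ∂ν - (m - c) ^ 2 := by
    rw [hexp, integral_add i1 (integrable_const _), integral_sub hfc2 i3, integral_const_mul, hmc,
      integral_const, probReal_univ, one_smul]
    ring
  rw [hI]
  have h2 : ∫ s, (f s - c) ^ 2 ∂ν ≤ T ^ 2 := by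
    calc ∫ s, (f s - c) ^ 2 ∂ν ≤ ∫ _s, T ^ 2 ∂ν :=
          integral_mono hfc2 (integrable_const _) fun s => by
            have := hT s
            calc (f s - c) ^ 2 = |f s - c| ^ 2 := (sq_abs _).symm
              _ ≤ T ^ 2 := pow_le_pow_left₀ (abs_nonneg _) this 2
      _ = T ^ 2 := by simp
  nlinarith [sq_nonneg (m - c)]

/-- **The tilt direction, Poincaré-free form.**  For a probability measure `μ`, bounded measurable tilts `U, U'` with
`|U − U' − w₀| ≤ θ` pointwise (a centred sup bound on the difference) and a bounded measurable `φ` with `|φ − b₀| ≤ Θ`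
pointwise: `|μ^U(φ) − μ^{U'}(φ)| ≤ Θ · θ · e^{2θ}`.  Proof: `μ^U = (μ^{U'})^{W}`, `W = U − U'` (`tilted_tilted`); one tilt
step is `Cov_ν(e^W, φ)/ν(e^W)`, `ν = μ^{U'}` (`integral_tilted_sub_integral_eq`); `|Cov_ν(e^W, φ)| ≤ √(Var e^W · Var φ)`
with `Var φ ≤ Θ²`, `Var e^W ≤ (θ e^{w₀+θ})²` (`integral_sq_sub_mean_le_of_abs_sub_le`), and `ν(e^W) ≥ e^{w₀−θ}`.  With `b₀` the
mid-range of an `L`-Lipschitz `φ` on a space of diameter `D` one takes `Θ = L D / 2` (`exists_centre_of_lipschitz`).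
Valid at every tilt, no Poincaré constant needed; where a (certified) Poincaré constant `c` of `μ^U` is available the
variance route gives the sharper `√(e^δ c) · Lip φ · ‖U − U'‖_∞`. [folklore] -/
theorem abs_integral_tilted_sub_tilted_le_of_centre {μ : Measure S} [IsProbabilityMeasure μ] {U U' φ : S → ℝ}
    {b₀ w₀ Θ θ : ℝ} (hU : Measurable U) (hUb : ∃ C, ∀ s, |U s| ≤ C) (hU' : Measurable U')
    (hU'b : ∃ C, ∀ s, |U' s| ≤ C) (hφ : Measurable φ) (hφΘ : ∀ s, |φ s - b₀| ≤ Θ)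
    (hW : ∀ s, |U s - U' s - w₀| ≤ θ) :
    |∫ s, φ s ∂μ.tilted U - ∫ s, φ s ∂μ.tilted U'| ≤ Θ * θ * exp (2 * θ) := by
  obtain ⟨s₀⟩ := nonempty_of_isProbabilityMeasure μ
  obtain ⟨CU, hCU⟩ := hUb
  obtain ⟨CU', hCU'⟩ := hU'b
  have hΘ : 0 ≤ Θ := (abs_nonneg _).trans (hφΘ s₀)
  have hθ : 0 ≤ θ := (abs_nonneg _).trans (hW s₀)
  set W : S → ℝ := fun s => U s - U' s with hWdef
  have hWm : Measurable W := hU.sub hU'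
  have hWup : ∀ s, W s ≤ w₀ + θ := fun s => by
    have := (abs_le.1 (hW s)).2; simp only [hWdef]; linarith
  have hWlow : ∀ s, w₀ - θ ≤ W s := fun s => by
    have := (abs_le.1 (hW s)).1; simp only [hWdef]; linarith
  have hWb : ∀ s, |W s| ≤ |w₀| + θ := fun s => by
    rw [abs_le]
    constructor
    · linarith [hWlow s, neg_abs_le w₀]
    · linarith [hWup s, le_abs_self w₀]
  have hexpU' : Integrable (fun s => exp (U' s)) μ := integrable_exp_of_abs_le hU' hCU'
  haveI : IsProbabilityMeasure (μ.tilted U') := isProbabilityMeasure_tilted hexpU'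
  have htilt : μ.tilted U = (μ.tilted U').tilted W := by
    rw [tilted_tilted hexpU' W]
    congr 1
    funext s
    simp only [Pi.add_apply, hWdef]
    ring
  have hexpW : Integrable (fun s => exp (W s)) (μ.tilted U') := integrable_exp_of_abs_le hWm hWb
  have hφb : ∃ C, ∀ s, |φ s| ≤ C := ⟨|b₀| + Θ, fun s => by
    calc |φ s| = |(φ s - b₀) + b₀| := by ring_nf
      _ ≤ |φ s - b₀| + |b₀| := abs_add_le _ _
      _ ≤ |b₀| + Θ := by linarith [hφΘ s]⟩
  rw [htilt, integral_tilted_sub_integral_eq hexpW]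
  -- the denominator
  have hZlow : exp (w₀ - θ) ≤ ∫ s, exp (W s) ∂μ.tilted U' := by
    calc exp (w₀ - θ) = ∫ _s, exp (w₀ - θ) ∂μ.tilted U' := by simp
      _ ≤ ∫ s, exp (W s) ∂μ.tilted U' :=
          integral_mono (integrable_const _) hexpW fun s => exp_le_exp.2 (hWlow s)
  have hZpos : 0 < ∫ s, exp (W s) ∂μ.tilted U' := (exp_pos _).trans_le hZlow
  rw [abs_div, abs_of_pos hZpos, div_le_iff₀ hZpos]
  -- the numerator: a covariance, bounded through the two variances
  have heWb : ∃ C, ∀ s, |exp (W s)| ≤ C := ⟨exp (|w₀| + θ), fun s => by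
    rw [abs_of_nonneg (exp_pos _).le]; exact exp_le_exp.2 ((le_abs_self _).trans (hWb s))⟩
  have heWT : ∀ s, |exp (W s) - exp w₀| ≤ θ * exp (w₀ + θ) := fun s => by
    calc |exp (W s) - exp w₀| ≤ exp (w₀ + θ) * |W s - w₀| :=
          abs_exp_sub_exp_le_of_le (hWup s) (by linarith)
      _ ≤ exp (w₀ + θ) * θ := by
          refine mul_le_mul_of_nonneg_left ?_ (exp_pos _).le
          have := hW s; simp only [hWdef]; exact this
      _ = θ * exp (w₀ + θ) := mul_comm _ _
  have hVf : ∫ s, (exp (W s) - ∫ s', exp (W s') ∂μ.tilted U') ^ 2 ∂μ.tilted U' ≤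
      (θ * exp (w₀ + θ)) ^ 2 / 1 := by
    rw [div_one]; exact integral_sq_sub_mean_le_of_abs_sub_le hWm.exp heWb heWT
  have hVg : ∫ s, (φ s - ∫ s', φ s' ∂μ.tilted U') ^ 2 ∂μ.tilted U' ≤ Θ ^ 2 / 1 := by
    rw [div_one]; exact integral_sq_sub_mean_le_of_abs_sub_le hφ hφb hφΘ
  have hcov := abs_integral_mul_sub_le_of_variance_le (ν := μ.tilted U') one_pos (by positivity) hΘ
    hWm.exp heWb hφ hφb hVf hVg
  rw [div_one] at hcov
  calc |∫ s, exp (W s) * φ s ∂μ.tilted U' - (∫ s, exp (W s) ∂μ.tilted U') * ∫ s, φ s ∂μ.tilted U'|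
      ≤ θ * exp (w₀ + θ) * Θ := hcov
    _ = Θ * θ * exp (2 * θ) * exp (w₀ - θ) := by
        have : exp (w₀ + θ) = exp (2 * θ) * exp (w₀ - θ) := by rw [← exp_add]; ring_nf
        rw [this]; ring
    _ ≤ Θ * θ * exp (2 * θ) * ∫ s, exp (W s) ∂μ.tilted U' :=
        mul_le_mul_of_nonneg_left hZlow (by positivity)

omit [MeasurableSpace S] in
/-- **A mid-range centre for a Lipschitz function**: on a nonempty space of `r`-diameter `≤ D`, a bounded `L`-Lipschitz `φ`
is within `L D / 2` of `b₀ = (sup φ + inf φ)/2`. [folklore] -/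
theorem exists_centre_of_lipschitz [Nonempty S] {r : S → S → ℝ} {φ : S → ℝ} {L D : ℝ}
    (hrD : ∀ a b, r a b ≤ D) (hφb : ∃ C, ∀ s, |φ s| ≤ C) (hL : 0 ≤ L)
    (hφL : ∀ a b, |φ a - φ b| ≤ L * r a b) : ∃ b₀ : ℝ, ∀ s, |φ s - b₀| ≤ L * D / 2 := by
  obtain ⟨C, hC⟩ := hφb
  have hup : BddAbove (Set.range φ) := ⟨C, by rintro _ ⟨s, rfl⟩; exact (le_abs_self _).trans (hC s)⟩
  have hlow : BddBelow (Set.range φ) := ⟨-C, by rintro _ ⟨s, rfl⟩; exact (neg_le.1 ((neg_le_abs _).trans (hC s)))⟩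
  set M : ℝ := ⨆ s, φ s with hM
  set m : ℝ := ⨅ s, φ s with hm
  have hleM : ∀ s, φ s ≤ M := fun s => le_ciSup hup s
  have hmle : ∀ s, m ≤ φ s := fun s => ciInf_le hlow s
  have hMm : M - L * D ≤ m := by
    refine le_ciInf fun t => ?_
    have h1 : M ≤ φ t + L * D := ciSup_le fun s => by
      have := (abs_le.1 (hφL s t)).2
      nlinarith [hrD s t]
    linarith
  refine ⟨(M + m) / 2, fun s => ?_⟩
  rw [abs_le]
  constructor
  · linarith [hleM s, hmle s]
  · linarith [hleM s, hmle s]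

end Abstract

end Summit.Ventures.YMGap.TiltStability
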